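import Summits.HodgeConjecture.HodgeConjecture.Theorems.K2LiuInertHeckeRecursion

/-!
# The Hecke transversal of `K_v t₁ K_v ∕ K_v` at an INERT unramified place lies in the Borel of the isotropic frame line:
# `q_v²` elements with frame matrix `(ϖ *; 0 ϖ⁻¹)`, `q_v − 1` with `(1 *; 0 1)`, and `t₁⁻¹ = (ϖ⁻¹ 0; 0 ϖ)` — the (hgy)(hgb) feed of ROAD A′
# for #24i (LOCAL SEAM of s23, inert package, organ (L24-b) (T))

Track B ∕ K2-LIT, hLiu418 = stmt-HodgeConjecture-24832; LEAD F0P6-plan (g11) «M-155g» (ii) deal «(L24-b) eigenvalue of `T(t₁)` on `[𝟙_𝒪]` by ROAD A′»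
→ K2Liu-p01 (g4); words `K2/K2Liu-p01/g3/INERT-SOCKETS-v2.K2Liup01g3.md` §3 and the (L24-b) REPORT-FIRST (K2 bus 04:26Z). Helper (count-neutral, own
head per LEAD R3). For the K2Lit CURVE datum `V = ⟨dV⟩` (`N = 2`), `v` INERT and UNRAMIFIED in `L`, a `σ_w`-fixed uniformizer `ϖ`, an integral hyperbolic
frame `T ∈ GL₂(𝒪_w)` of the place form (`diag(dV)_w = σ_w(T)ᵀ·antidiag(1,1)·T`) and a generator `t₁ ∈ G_v` with `(t₁)_w = T⁻¹·diag(ϖ, ϖ⁻¹)·T`: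

* §1 `exists_frameEquiv_inert'` — ★ H3a's frame isomorphism `Ψ : G_v ≃* U(σ_w, J₀)(L_w)` WITH its matrix `(Ψ g : GL₂) = T·g_w·T⁻¹` exported;
* §2 **`exists_heckeTransversal_borel_inert`** — a transversal `X₊ ∪ X₀ ∪ {t₁⁻¹}` of `K_v t₁ K_v ∕ K_v` (`|X₊| = q_v²`, `|X₀| = q_v − 1`, ★ H2
  `exists_contractingTransversal_unitary_two` pulled back along `Ψ`) together with the FRAME NORMAL FORMS of its members:
  `x_w = T⁻¹·(U·diag(ϖ,ϖ⁻¹))·T` (`x ∈ X₊`), `x_w = T⁻¹·(diag(ϖ,ϖ⁻¹)⁻¹·U·diag(ϖ,ϖ⁻¹))·T` (`x ∈ X₀`), `U` upper unitriangular with integral corner, and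
  `(t₁⁻¹)_w = T⁻¹·diag(ϖ,ϖ⁻¹)⁻¹·T`;
* §3 `mulVec_frameVec_of_eq_conj` + **`heckeTransversal_mulVec_frameVec_inert`** — hence every member `x` scales the isotropic frame vector
  `y := T⁻¹e₀` (`h_w(y,y) = 0`, `h_w(y, T⁻¹e₁) = 1` by `hTJ`): `x_w y = ϖ·y ∣ y ∣ ϖ⁻¹·y` on `X₊ ∣ X₀ ∣ t₁⁻¹` — the hypotheses `(hgy)` (and, `y^⊥ = S·y` at
  `N = 2`, `(hgb)`) of ★ (C3′) `F0P2oDoubledSwapSiegel.exists_involution_forall_isSiegelDelta` (generic `n`) for ROAD A′'s eigen-law ★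
  `LocalSplittingCMParabolicEigenfunctional.apply_zero_toRep_mul_localSplitting_eq_mul`: `a₁ = q²·(Zq)⁻¹ + (q−1)·1 + Zq = q(Z + Z⁻¹) + q − 1`.
[BruhatTits1972, (4.4.3)–(4.4.4)]; [SerreTrees1980, II.1.1]; [GelbartRogawski1991, §3.2 (3.2.2)]; [Kudla1994, §3 Thm. 3.1]. No `def`, no `sorry`.
HONEST LABEL: HC_CM is proved only modulo the printed citations (2 remaining named inputs: hLiu418 = stmt-HodgeConjecture-24832, h413 =
stmt-HodgeConjecture-24833) until rung 0 closes; this file is unconditional and moves no counter.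
-/

set_option autoImplicit false

set_option linter.dupNamespace false

noncomputable section

open scoped Matrix Pointwise Valued
open NumberField IsDedekindDomain Matrix MulAction ConjAct

namespace Summit.HodgeConjecture.HodgeConjecture.Cruxes.HLiu418.K2LiuInertHeckeTransversalBorel

open Literature.NumberTheory.Automorphic Literature.NumberTheory.Automorphic.UnitaryGroup Literature.NumberTheory.Automorphic.HermitianLattice
open Literature.NumberTheory.Automorphic.CartanUnique Literature.NumberTheory.Automorphic.SphericalCoefficient
open Literature.NumberTheory.GelbartRogawski1991 Literature.NumberTheory.GelbartRogawski1991.GRConstruction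
open Literature.NumberTheory.GaloisRepresentations
open Summit.HodgeConjecture.HodgeConjecture.Cruxes.HLiu418.K2LiuRankOneHeckeCellsTwo
open Summit.HodgeConjecture.HodgeConjecture.Cruxes.HLiu418.K2LiuRankOneHeckeNeighboursTwo
open Summit.HodgeConjecture.HodgeConjecture.Cruxes.HLiu418.K2LiuInertHeckeRecursion

variable (L : Type) [Field L] [NumberField L] [IsCMField L]
variable (dV : Fin 2 → L) (v : HeightOneSpectrum (𝓞 (Fp L)))

/-! ## §1 The frame isomorphism with its matrix -/

/-- **The frame isomorphism, with its matrix**: `Ψ : G_v ≃* U(σ_w, J₀)(L_w)`, `(Ψ g : GL₂) = T·g_w·T⁻¹`, `g ∈ K_v ↔ Ψ g ∈ K₀`, `(Ψ t₁ : GL₂) = diag(ϖ, ϖ⁻¹)`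
(★ H3a `exists_frameEquiv_inert` with the matrix clause exported). [cite: BruhatTits1972, (4.4.3)] [cite: PlatonovRapinchuk1994, §5.1] -/
theorem exists_frameEquiv_inert' (w : UnitaryGroup.PlacesOver L v) (hw : IsCMField.complexConj L • w.1 = w.1)
    {ϖ : w.1.adicCompletion L} (hϖ : Valued.v ϖ = WithZero.exp (-1 : ℤ))
    (T : GL (Fin 2) (w.1.adicCompletion L)) (hTi : T ∈ glInt 2 (w.1.adicCompletion L))
    (hTJ : UnitaryGroup.placeForm (Matrix.diagonal dV) w.1 =
      formCongr (galAdicCompletionMap (L := L) (IsCMField.complexConj L) hw) T ((StdForm.antidiagonal 2).over (w.1.adicCompletion L)))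
    (t₁ : UnitaryGroup.localPi L (IsCMField.complexConj L) 2 (Matrix.diagonal dV) v)
    (ht₁ : Units.val ((t₁ : UnitaryGroup.LocalGLPi L 2 v) w) =
      ((T⁻¹ : GL (Fin 2) (w.1.adicCompletion L)) : Matrix (Fin 2) (Fin 2) (w.1.adicCompletion L)) *
        Matrix.diagonal ![ϖ, ϖ⁻¹] * (T : Matrix (Fin 2) (Fin 2) (w.1.adicCompletion L))) :
    ∃ Ψ : UnitaryGroup.localPi L (IsCMField.complexConj L) 2 (Matrix.diagonal dV) v ≃*
        unitaryGroupOfForm (galAdicCompletionMap (L := L) (IsCMField.complexConj L) hw) ((StdForm.antidiagonal 2).over (w.1.adicCompletion L)),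
      (∀ g, ((Ψ g : unitaryGroupOfForm (galAdicCompletionMap (L := L) (IsCMField.complexConj L) hw) ((StdForm.antidiagonal 2).over (w.1.adicCompletion L))) :
          GL (Fin 2) (w.1.adicCompletion L)) = T * (g : UnitaryGroup.LocalGLPi L 2 v) w * T⁻¹) ∧
      (∀ g, g ∈ UnitaryGroup.localInt L (IsCMField.complexConj L) 2 (Matrix.diagonal dV) v ↔
        Ψ g ∈ unitaryInt (galAdicCompletionMap (L := L) (IsCMField.complexConj L) hw) ((StdForm.antidiagonal 2).over (w.1.adicCompletion L))) ∧
      ((Ψ t₁ : unitaryGroupOfForm (galAdicCompletionMap (L := L) (IsCMField.complexConj L) hw) ((StdForm.antidiagonal 2).over (w.1.adicCompletion L))) :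
          GL (Fin 2) (w.1.adicCompletion L)) = zpowDiagGL (uniformizer_ne_zero hϖ) ![(1 : ℤ), -1] := by
  haveI : Algebra.IsQuadraticExtension (Fp L) L := IsCMField.isQuadraticExtension L
  have hc : IsCMField.complexConj L ≠ 1 := IsCMField.complexConj_ne_one L
  set σ : w.1.adicCompletion L →+* w.1.adicCompletion L := galAdicCompletionMap (L := L) (IsCMField.complexConj L) hw with hσ
  have hUU : unitaryGroupOfForm σ (UnitaryGroup.placeForm (Matrix.diagonal dV) w.1) =
      unitaryGroupOfForm σ (formCongr σ T ((StdForm.antidiagonal 2).over (w.1.adicCompletion L))) := by rw [hTJ]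
  let Ψ : UnitaryGroup.localPi L (IsCMField.complexConj L) 2 (Matrix.diagonal dV) v ≃*
      unitaryGroupOfForm σ ((StdForm.antidiagonal 2).over (w.1.adicCompletion L)) :=
    (localPiNonsplitEquiv (IsCMField.complexConj L) (Matrix.diagonal dV) hc w hw).toMulEquiv.trans
      ((MulEquiv.subgroupCongr hUU).trans (unitaryGroupOfFormCongr σ T ((StdForm.antidiagonal 2).over (w.1.adicCompletion L))).toMulEquiv)
  have hΨ : ∀ u, ((Ψ u : unitaryGroupOfForm σ ((StdForm.antidiagonal 2).over (w.1.adicCompletion L))) : GL (Fin 2) (w.1.adicCompletion L)) =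
      T * (u : UnitaryGroup.LocalGLPi L 2 v) w * T⁻¹ := fun u => rfl
  have hgl : ∀ g : GL (Fin 2) (w.1.adicCompletion L), g ∈ glInt 2 (w.1.adicCompletion L) ↔
      (∀ i j, Valued.v ((g : Matrix (Fin 2) (Fin 2) (w.1.adicCompletion L)) i j) ≤ 1) ∧
        ∀ i j, Valued.v (((g⁻¹ : GL (Fin 2) (w.1.adicCompletion L)) : Matrix (Fin 2) (Fin 2) (w.1.adicCompletion L)) i j) ≤ 1 := by
    intro g
    rw [mem_glInt_adicCompletion_iff]
    simp only [HeightOneSpectrum.mem_adicCompletionIntegers]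
  refine ⟨Ψ, hΨ, fun u => ?_, ?_⟩
  · rw [mem_localInt_iff_of_smul_eq (IsCMField.complexConj L) 2 (Matrix.diagonal dV) hc w hw u, mem_unitaryInt_iff, hΨ, ← hgl]
    constructor
    · intro h; exact Subgroup.mul_mem _ (Subgroup.mul_mem _ hTi h) (Subgroup.inv_mem _ hTi)
    · intro h
      have h' := Subgroup.mul_mem _ (Subgroup.mul_mem _ (Subgroup.inv_mem _ hTi) h) hTi
      rwa [show T⁻¹ * (T * (u : UnitaryGroup.LocalGLPi L 2 v) w * T⁻¹) * T = (u : UnitaryGroup.LocalGLPi L 2 v) w by group] at h'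
  · apply Units.ext
    rw [hΨ t₁, Units.val_mul, Units.val_mul, ht₁, coe_zpowDiagGL]
    have h1 : (T : Matrix (Fin 2) (Fin 2) (w.1.adicCompletion L)) * ((T⁻¹ : GL (Fin 2) (w.1.adicCompletion L)) : Matrix _ _ _) = 1 := by
      rw [← Units.val_mul, mul_inv_cancel, Units.val_one]
    have hD : (Matrix.diagonal ![ϖ, ϖ⁻¹] : Matrix (Fin 2) (Fin 2) (w.1.adicCompletion L)) = Matrix.diagonal fun i => ϖ ^ (![(1 : ℤ), -1] i) := by
      congr 1; funext i; fin_cases i <;> simp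
    calc (T : Matrix (Fin 2) (Fin 2) (w.1.adicCompletion L)) *
          (((T⁻¹ : GL (Fin 2) (w.1.adicCompletion L)) : Matrix _ _ _) * Matrix.diagonal ![ϖ, ϖ⁻¹] * (T : Matrix _ _ _)) *
          ((T⁻¹ : GL (Fin 2) (w.1.adicCompletion L)) : Matrix _ _ _)
        = ((T : Matrix (Fin 2) (Fin 2) (w.1.adicCompletion L)) * ((T⁻¹ : GL (Fin 2) (w.1.adicCompletion L)) : Matrix _ _ _)) *
            Matrix.diagonal ![ϖ, ϖ⁻¹] *
            ((T : Matrix (Fin 2) (Fin 2) (w.1.adicCompletion L)) * ((T⁻¹ : GL (Fin 2) (w.1.adicCompletion L)) : Matrix _ _ _)) := by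
          simp only [Matrix.mul_assoc]
      _ = Matrix.diagonal fun i => ϖ ^ (![(1 : ℤ), -1] i) := by rw [h1, Matrix.one_mul, Matrix.mul_one, hD]

/-! ## §2 The transversal and the frame normal forms of its members -/

set_option maxHeartbeats 800000 in -- measured 2026-09-04 (as ★ H3a `exists_contractingTransversal_inert`): the adelic unitary datum (`localPi`, `localInt`, quotient, orbits, transport)
/-- **THE HECKE TRANSVERSAL OF `K_v t₁ K_v ∕ K_v` AND ITS FRAME NORMAL FORMS** (inert unramified `v`): there are finite `X₊`, `X₀ ⊆ G_v` with
`X₊ ∪ X₀ ∪ {t₁⁻¹}` a transversal of `K_v t₁ K_v ∕ K_v`, `|X₊| = q_v²`, `|X₀| = q_v − 1`, and for the frame `T`, `D := diag(ϖ, ϖ⁻¹) = zpowDiagGL (1,−1)`: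
every `x ∈ X₊` has `x_w = T⁻¹·(U·D)·T`, every `x ∈ X₀` has `x_w = T⁻¹·(D⁻¹·U·D)·T`, with `U ∈ GL₂(L_w)` UPPER UNITRIANGULAR and `v(U₀₁) ≤ 1`, and
`(t₁⁻¹)_w = T⁻¹·D⁻¹·T` — ★ H2 `exists_contractingTransversal_unitary_two` (`X₊ = R₊·t`, `R₊ ⊆ K_P = N(𝒪)`; `X₀ ⊆ t⁻¹K_Pt`) read through `Ψ g = T g_w T⁻¹`.
[cite: BruhatTits1972, (4.4.4)] [cite: SerreTrees1980, II.1.1] [cite: Rogawski1990, §1.10 p. 14] -/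
theorem exists_heckeTransversal_borel_inert [DecidableEq (UnitaryGroup.localPi L (IsCMField.complexConj L) 2 (Matrix.diagonal dV) v)]
    (w : UnitaryGroup.PlacesOver L v) (hw : IsCMField.complexConj L • w.1 = w.1)
    (hv : Algebra.IsUnramifiedIn (𝓞 L) v.asIdeal)
    {ϖ : w.1.adicCompletion L} (hϖ : Valued.v ϖ = WithZero.exp (-1 : ℤ))
    (hϖσ : galAdicCompletionMap (L := L) (IsCMField.complexConj L) hw ϖ = ϖ)
    (T : GL (Fin 2) (w.1.adicCompletion L)) (hTi : T ∈ glInt 2 (w.1.adicCompletion L))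
    (hTJ : UnitaryGroup.placeForm (Matrix.diagonal dV) w.1 =
      formCongr (galAdicCompletionMap (L := L) (IsCMField.complexConj L) hw) T ((StdForm.antidiagonal 2).over (w.1.adicCompletion L)))
    (t₁ : UnitaryGroup.localPi L (IsCMField.complexConj L) 2 (Matrix.diagonal dV) v)
    (ht₁ : Units.val ((t₁ : UnitaryGroup.LocalGLPi L 2 v) w) =
      ((T⁻¹ : GL (Fin 2) (w.1.adicCompletion L)) : Matrix (Fin 2) (Fin 2) (w.1.adicCompletion L)) *
        Matrix.diagonal ![ϖ, ϖ⁻¹] * (T : Matrix (Fin 2) (Fin 2) (w.1.adicCompletion L))) :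
    ∃ Xp X0 : Finset (UnitaryGroup.localPi L (IsCMField.complexConj L) 2 (Matrix.diagonal dV) v),
      Set.BijOn (fun x : UnitaryGroup.localPi L (IsCMField.complexConj L) 2 (Matrix.diagonal dV) v =>
          (x : UnitaryGroup.localPi L (IsCMField.complexConj L) 2 (Matrix.diagonal dV) v ⧸
            UnitaryGroup.localInt L (IsCMField.complexConj L) 2 (Matrix.diagonal dV) v))
        (Xp ∪ X0 ∪ {t₁⁻¹} : Finset _)
        (orbit (UnitaryGroup.localInt L (IsCMField.complexConj L) 2 (Matrix.diagonal dV) v)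
          (t₁ : UnitaryGroup.localPi L (IsCMField.complexConj L) 2 (Matrix.diagonal dV) v ⧸
            UnitaryGroup.localInt L (IsCMField.complexConj L) 2 (Matrix.diagonal dV) v)) ∧
      Xp.card = v.residueCard ^ 2 ∧ X0.card = v.residueCard - 1 ∧
      (∀ x ∈ Xp, ∃ U : GL (Fin 2) (w.1.adicCompletion L), U ∈ upperUnitriangular (Fin 2) (w.1.adicCompletion L) ∧
        Valued.v ((U : Matrix (Fin 2) (Fin 2) (w.1.adicCompletion L)) 0 1) ≤ 1 ∧
        (x : UnitaryGroup.LocalGLPi L 2 v) w = T⁻¹ * (U * zpowDiagGL (uniformizer_ne_zero hϖ) ![(1 : ℤ), -1]) * T) ∧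
      (∀ x ∈ X0, ∃ U : GL (Fin 2) (w.1.adicCompletion L), U ∈ upperUnitriangular (Fin 2) (w.1.adicCompletion L) ∧
        Valued.v ((U : Matrix (Fin 2) (Fin 2) (w.1.adicCompletion L)) 0 1) ≤ 1 ∧
        (x : UnitaryGroup.LocalGLPi L 2 v) w =
          T⁻¹ * ((zpowDiagGL (uniformizer_ne_zero hϖ) ![(1 : ℤ), -1])⁻¹ * U * zpowDiagGL (uniformizer_ne_zero hϖ) ![(1 : ℤ), -1]) * T) ∧
      (t₁⁻¹ : UnitaryGroup.LocalGLPi L 2 v) w = T⁻¹ * (zpowDiagGL (uniformizer_ne_zero hϖ) ![(1 : ℤ), -1])⁻¹ * T := by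
  classical
  haveI : Algebra.IsQuadraticExtension (Fp L) L := IsCMField.isQuadraticExtension L
  have hc : IsCMField.complexConj L ≠ 1 := IsCMField.complexConj_ne_one L
  set Kv := UnitaryGroup.localInt L (IsCMField.complexConj L) 2 (Matrix.diagonal dV) v with hKvdef
  set σ : w.1.adicCompletion L →+* w.1.adicCompletion L := galAdicCompletionMap (L := L) (IsCMField.complexConj L) hw with hσ
  obtain ⟨ϖ₀, hd₀⟩ := unramifiedLocalConjDatum_adicCompletion (IsCMField.complexConj L) hc v w hw hv
  have hd : UnramifiedLocalConjDatum σ ϖ := ⟨hd₀.σσ, hd₀.vσ, hϖσ, hϖ, hd₀.trace, hd₀.norm⟩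
  have hσne : ∃ x : w.1.adicCompletion L, σ x ≠ x := exists_galAdicCompletionMap_ne L v w hw
  haveI : Finite 𝓀[w.1.adicCompletion L] := finite_residueField_adicCompletion L w.1
  obtain ⟨Ψ, hΨ, hKΨ, hΨt₁⟩ := exists_frameEquiv_inert' L dV v w hw hϖ T hTi hTJ t₁ ht₁
  set K₀ := unitaryInt σ ((StdForm.antidiagonal 2).over (w.1.adicCompletion L)) with hK₀def
  have hKeq : K₀.comap (Ψ : UnitaryGroup.localPi L (IsCMField.complexConj L) 2 (Matrix.diagonal dV) v →*
      unitaryGroupOfForm σ ((StdForm.antidiagonal 2).over (w.1.adicCompletion L))) = Kv := by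
    ext g
    rw [Subgroup.mem_comap, MonoidHom.coe_coe]
    exact (hKΨ g).symm
  have ht' : (((Ψ t₁ : unitaryGroupOfForm σ ((StdForm.antidiagonal 2).over (w.1.adicCompletion L))) : GL (Fin 2) (w.1.adicCompletion L)) =
      zpowDiagGL (uniformizer_ne_zero hd.vϖ) ![(1 : ℤ), -1]) := hΨt₁
  -- the datum in the model group, with `X₊ = R₊·t`, `R₊ ⊆ K_P`
  obtain ⟨Rp, hRp, hRp_inj, hRp_surj, hcardp⟩ := exists_transversal_borelInt_two hd hσne ht'
  obtain ⟨R0, hR0, hR0_inj, hR0_surj, hcard0⟩ := exists_transversal_unip_two hd hσne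
  have hX' := bijOn_heckeNeighbours_two hd ht' hRp hRp_inj hRp_surj hR0 hR0_inj hR0_surj
  have ht₁e : Ψ.symm (Ψ t₁) = t₁ := Ψ.symm_apply_apply t₁
  -- reading `x_w` through `Ψ`: `x_w = T⁻¹ (Ψ x) T`
  have hread : ∀ g : UnitaryGroup.localPi L (IsCMField.complexConj L) 2 (Matrix.diagonal dV) v,
      (g : UnitaryGroup.LocalGLPi L 2 v) w =
        T⁻¹ * ((Ψ g : unitaryGroupOfForm σ ((StdForm.antidiagonal 2).over (w.1.adicCompletion L))) : GL (Fin 2) (w.1.adicCompletion L)) * T := by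
    intro g; rw [hΨ g]; group
  refine ⟨(Rp.image (· * Ψ t₁)).image Ψ.symm, R0.image Ψ.symm, ?_, ?_, ?_, ?_, ?_, ?_⟩
  · have hXset : ((((Rp.image (· * Ψ t₁)).image Ψ.symm) ∪ R0.image Ψ.symm ∪ {t₁⁻¹} : Finset _) : Set _) =
        Ψ.symm '' ((Rp.image (· * Ψ t₁) ∪ R0 ∪ {(Ψ t₁)⁻¹} : Finset _) : Set _) := by
      simp only [Finset.coe_union, Finset.coe_image, Finset.coe_singleton, Set.image_union, Set.image_singleton, map_inv, ht₁e]
    have h := bijOn_coe_orbit_preimage Ψ (K' := K₀) hX'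
    rw [ht₁e, hKeq] at h
    rw [hXset]
    exact h
  · rw [Finset.card_image_of_injective _ Ψ.symm.injective, Finset.card_image_of_injective _ (mul_left_injective (Ψ t₁)), hcardp,
      natCard_residueField_eq_sq_inert L v w hw hv]
  · rw [Finset.card_image_of_injective _ Ψ.symm.injective, hcard0, natCard_residueField_eq_sq_inert L v w hw hv, Nat.sqrt_eq']
  · intro x hx
    obtain ⟨x', hx', rfl⟩ := Finset.mem_image.1 hx
    obtain ⟨u, hu, rfl⟩ := Finset.mem_image.1 hx'
    obtain ⟨huU, huv⟩ := (hd.mem_borelInt_iff_two).1 (hRp u hu)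
    refine ⟨(u : GL (Fin 2) (w.1.adicCompletion L)), huU, huv, ?_⟩
    rw [hread, MulEquiv.apply_symm_apply, Subgroup.coe_mul, ht']
  · intro x hx
    obtain ⟨u, hu, rfl⟩ := Finset.mem_image.1 hx
    -- `Ψ t₁ · u · (Ψ t₁)⁻¹ ∈ K_P`
    have hconj : Ψ t₁ * u * (Ψ t₁)⁻¹ ∈ hd.borelLatticeU ⊓ unitaryInt σ ((StdForm.antidiagonal 2).over (w.1.adicCompletion L)) :=
      conj_unip_mem_borelInt_two hd ht' (hR0 u hu).1 (by rw [(hR0 u hu).2, WithZero.exp_le_exp]; norm_num)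
    obtain ⟨hU, hUv⟩ := (hd.mem_borelInt_iff_two).1 hconj
    refine ⟨((Ψ t₁ * u * (Ψ t₁)⁻¹ : unitaryGroupOfForm σ ((StdForm.antidiagonal 2).over (w.1.adicCompletion L))) : GL (Fin 2) (w.1.adicCompletion L)),
      hU, hUv, ?_⟩
    rw [hread, MulEquiv.apply_symm_apply, Subgroup.coe_mul, Subgroup.coe_mul, Subgroup.coe_inv, ht']
    group
  · rw [← Subgroup.coe_inv, hread, map_inv, Subgroup.coe_inv, ht']

/-! ## §3 The members scale the isotropic frame vector `y = T⁻¹ e₀` -/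

/-- matrix bookkeeping: `(T⁻¹ M T)·(T⁻¹ e₀) = T⁻¹ (M e₀)`, and `M e₀ = M₀₀ e₀` when `M₁₀ = 0`; so a frame-upper-triangular element scales
`y = T⁻¹ e₀` by its corner entry. [folklore] -/
theorem mulVec_frameVec_of_eq_conj {Kw : Type*} [Field Kw] (T : GL (Fin 2) Kw) (M : Matrix (Fin 2) (Fin 2) Kw) (hM : M 1 0 = 0) :
    (((T⁻¹ : GL (Fin 2) Kw) : Matrix (Fin 2) (Fin 2) Kw) * M * (T : Matrix (Fin 2) (Fin 2) Kw)) *ᵥ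
        (((T⁻¹ : GL (Fin 2) Kw) : Matrix (Fin 2) (Fin 2) Kw) *ᵥ Pi.single 0 1) =
      M 0 0 • (((T⁻¹ : GL (Fin 2) Kw) : Matrix (Fin 2) (Fin 2) Kw) *ᵥ Pi.single 0 1) := by
  have hTT : (T : Matrix (Fin 2) (Fin 2) Kw) * ((T⁻¹ : GL (Fin 2) Kw) : Matrix (Fin 2) (Fin 2) Kw) = 1 := by
    rw [← Units.val_mul, mul_inv_cancel, Units.val_one]
  have hMe : M *ᵥ (Pi.single 0 1 : Fin 2 → Kw) = M 0 0 • (Pi.single 0 1 : Fin 2 → Kw) := by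
    ext i
    rw [Matrix.mulVec_single_one, Pi.smul_apply, smul_eq_mul]
    fin_cases i
    · simp
    · simp [hM]
  rw [Matrix.mulVec_mulVec, Matrix.mul_assoc _ (T : Matrix (Fin 2) (Fin 2) Kw), hTT, Matrix.mul_one, ← Matrix.mulVec_mulVec, hMe,
    Matrix.mulVec_smul]

/-- the corner entries of the three normal forms: `(U·D)₀₀ = ϖ`, `(U·D)₁₀ = 0`; `(D⁻¹·U·D)₀₀ = 1`, `(D⁻¹·U·D)₁₀ = 0`; `(D⁻¹)₀₀ = ϖ⁻¹`, `(D⁻¹)₁₀ = 0`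
(`D = diag(ϖ, ϖ⁻¹)`, `U` upper unitriangular). [folklore] -/
theorem corner_entries {Kw : Type*} [Field Kw] {ϖ : Kw} (hϖ0 : ϖ ≠ 0) (U : GL (Fin 2) Kw) (hU : U ∈ upperUnitriangular (Fin 2) Kw) :
    ((U * zpowDiagGL hϖ0 ![(1 : ℤ), -1] : GL (Fin 2) Kw) : Matrix (Fin 2) (Fin 2) Kw) 0 0 = ϖ ∧
    ((U * zpowDiagGL hϖ0 ![(1 : ℤ), -1] : GL (Fin 2) Kw) : Matrix (Fin 2) (Fin 2) Kw) 1 0 = 0 ∧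
    (((zpowDiagGL hϖ0 ![(1 : ℤ), -1])⁻¹ * U * zpowDiagGL hϖ0 ![(1 : ℤ), -1] : GL (Fin 2) Kw) : Matrix (Fin 2) (Fin 2) Kw) 0 0 = 1 ∧
    (((zpowDiagGL hϖ0 ![(1 : ℤ), -1])⁻¹ * U * zpowDiagGL hϖ0 ![(1 : ℤ), -1] : GL (Fin 2) Kw) : Matrix (Fin 2) (Fin 2) Kw) 1 0 = 0 ∧
    (((zpowDiagGL hϖ0 ![(1 : ℤ), -1])⁻¹ : GL (Fin 2) Kw) : Matrix (Fin 2) (Fin 2) Kw) 0 0 = ϖ⁻¹ ∧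
    (((zpowDiagGL hϖ0 ![(1 : ℤ), -1])⁻¹ : GL (Fin 2) Kw) : Matrix (Fin 2) (Fin 2) Kw) 1 0 = 0 := by
  have hT := blockTriangular_of_mem_upperUnitriangular hU
  have hdiag := apply_self_of_mem_upperUnitriangular hU
  have h10 : ((U : GL (Fin 2) Kw) : Matrix (Fin 2) (Fin 2) Kw) 1 0 = 0 := hT (by decide)
  refine ⟨?_, ?_, ?_, ?_, ?_, ?_⟩
  · rw [Units.val_mul, coe_zpowDiagGL, Matrix.mul_diagonal, hdiag]; simp
  · rw [Units.val_mul, coe_zpowDiagGL, Matrix.mul_diagonal, h10, zero_mul]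
  · rw [coe_zpowDiagGL_inv_mul_mul_zpowDiagGL_apply, hdiag, sub_self, zpow_zero, one_mul]
  · rw [coe_zpowDiagGL_inv_mul_mul_zpowDiagGL_apply, h10, mul_zero]
  · rw [← zpowDiagGL_neg, coe_zpowDiagGL, Matrix.diagonal_apply_eq]; simp
  · rw [← zpowDiagGL_neg, coe_zpowDiagGL, Matrix.diagonal_apply_ne _ (by decide)]

set_option maxHeartbeats 800000 in -- measured 2026-09-04 (as §2): the adelic unitary datum
/-- **THE MEMBERS OF THE HECKE TRANSVERSAL SCALE THE ISOTROPIC FRAME VECTOR**: with `y := T⁻¹ e₀` (an isotropic vector of the place form at `w`,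
`h_w(y, T⁻¹e₁) = 1`, by `hTJ`), every `x ∈ X₊` has `x_w y = ϖ·y`, every `x ∈ X₀` has `x_w y = y`, and `(t₁⁻¹)_w y = ϖ⁻¹·y` — the hypotheses `(hgy)`
(and, `y^⊥ = S·y` for `N = 2`, `(hgb)` with `α = ϖ ∣ 1 ∣ ϖ⁻¹`) of ★ (C3′) `exists_involution_forall_isSiegelDelta` along the Hecke sum
`T(t₁) = Σ_{x ∈ X₊ ⊔ X₀ ⊔ {t₁⁻¹}} x` of ROAD A′. [cite: GelbartRogawski1991, §3.2 (3.2.2) p. 457] [cite: Kudla1994, §3 Thm. 3.1] [cite: BruhatTits1972, (4.4.4)] -/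
theorem heckeTransversal_mulVec_frameVec_inert [DecidableEq (UnitaryGroup.localPi L (IsCMField.complexConj L) 2 (Matrix.diagonal dV) v)]
    (w : UnitaryGroup.PlacesOver L v) (hw : IsCMField.complexConj L • w.1 = w.1)
    (hv : Algebra.IsUnramifiedIn (𝓞 L) v.asIdeal)
    {ϖ : w.1.adicCompletion L} (hϖ : Valued.v ϖ = WithZero.exp (-1 : ℤ))
    (hϖσ : galAdicCompletionMap (L := L) (IsCMField.complexConj L) hw ϖ = ϖ)
    (T : GL (Fin 2) (w.1.adicCompletion L)) (hTi : T ∈ glInt 2 (w.1.adicCompletion L))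
    (hTJ : UnitaryGroup.placeForm (Matrix.diagonal dV) w.1 =
      formCongr (galAdicCompletionMap (L := L) (IsCMField.complexConj L) hw) T ((StdForm.antidiagonal 2).over (w.1.adicCompletion L)))
    (t₁ : UnitaryGroup.localPi L (IsCMField.complexConj L) 2 (Matrix.diagonal dV) v)
    (ht₁ : Units.val ((t₁ : UnitaryGroup.LocalGLPi L 2 v) w) =
      ((T⁻¹ : GL (Fin 2) (w.1.adicCompletion L)) : Matrix (Fin 2) (Fin 2) (w.1.adicCompletion L)) *
        Matrix.diagonal ![ϖ, ϖ⁻¹] * (T : Matrix (Fin 2) (Fin 2) (w.1.adicCompletion L))) :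
    ∃ Xp X0 : Finset (UnitaryGroup.localPi L (IsCMField.complexConj L) 2 (Matrix.diagonal dV) v),
      Set.BijOn (fun x : UnitaryGroup.localPi L (IsCMField.complexConj L) 2 (Matrix.diagonal dV) v =>
          (x : UnitaryGroup.localPi L (IsCMField.complexConj L) 2 (Matrix.diagonal dV) v ⧸
            UnitaryGroup.localInt L (IsCMField.complexConj L) 2 (Matrix.diagonal dV) v))
        (Xp ∪ X0 ∪ {t₁⁻¹} : Finset _)
        (orbit (UnitaryGroup.localInt L (IsCMField.complexConj L) 2 (Matrix.diagonal dV) v)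
          (t₁ : UnitaryGroup.localPi L (IsCMField.complexConj L) 2 (Matrix.diagonal dV) v ⧸
            UnitaryGroup.localInt L (IsCMField.complexConj L) 2 (Matrix.diagonal dV) v)) ∧
      Xp.card = v.residueCard ^ 2 ∧ X0.card = v.residueCard - 1 ∧
      (∀ x ∈ Xp, Units.val ((x : UnitaryGroup.LocalGLPi L 2 v) w) *ᵥ
          (((T⁻¹ : GL (Fin 2) (w.1.adicCompletion L)) : Matrix (Fin 2) (Fin 2) (w.1.adicCompletion L)) *ᵥ Pi.single 0 1) =
        ϖ • (((T⁻¹ : GL (Fin 2) (w.1.adicCompletion L)) : Matrix (Fin 2) (Fin 2) (w.1.adicCompletion L)) *ᵥ Pi.single 0 1)) ∧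
      (∀ x ∈ X0, Units.val ((x : UnitaryGroup.LocalGLPi L 2 v) w) *ᵥ
          (((T⁻¹ : GL (Fin 2) (w.1.adicCompletion L)) : Matrix (Fin 2) (Fin 2) (w.1.adicCompletion L)) *ᵥ Pi.single 0 1) =
        (((T⁻¹ : GL (Fin 2) (w.1.adicCompletion L)) : Matrix (Fin 2) (Fin 2) (w.1.adicCompletion L)) *ᵥ Pi.single 0 1)) ∧
      Units.val ((t₁⁻¹ : UnitaryGroup.LocalGLPi L 2 v) w) *ᵥ
          (((T⁻¹ : GL (Fin 2) (w.1.adicCompletion L)) : Matrix (Fin 2) (Fin 2) (w.1.adicCompletion L)) *ᵥ Pi.single 0 1) =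
        ϖ⁻¹ • (((T⁻¹ : GL (Fin 2) (w.1.adicCompletion L)) : Matrix (Fin 2) (Fin 2) (w.1.adicCompletion L)) *ᵥ Pi.single 0 1) := by
  obtain ⟨Xp, X0, hX, hcp, hc0, hXp, hX0, hti⟩ := exists_heckeTransversal_borel_inert L dV v w hw hv hϖ hϖσ T hTi hTJ t₁ ht₁
  have hϖ0 : ϖ ≠ 0 := uniformizer_ne_zero hϖ
  refine ⟨Xp, X0, hX, hcp, hc0, fun x hx => ?_, fun x hx => ?_, ?_⟩
  · obtain ⟨U, hU, -, hxw⟩ := hXp x hx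
    obtain ⟨h00, h10, -, -, -, -⟩ := corner_entries hϖ0 U hU
    rw [hxw, Units.val_mul, Units.val_mul, mulVec_frameVec_of_eq_conj T _ h10, h00]
  · obtain ⟨U, hU, -, hxw⟩ := hX0 x hx
    obtain ⟨-, -, h00, h10, -, -⟩ := corner_entries hϖ0 U hU
    rw [hxw, Units.val_mul, Units.val_mul, mulVec_frameVec_of_eq_conj T _ h10, h00, one_smul]
  · obtain ⟨-, -, -, -, h00, h10⟩ := corner_entries hϖ0 (1 : GL (Fin 2) (w.1.adicCompletion L)) (Subgroup.one_mem _)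
    rw [hti, Units.val_mul, Units.val_mul, mulVec_frameVec_of_eq_conj T _ h10, h00]

end Summit.HodgeConjecture.HodgeConjecture.Cruxes.HLiu418.K2LiuInertHeckeTransversalBorel

end
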